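/-
Copyright: seat `ym-line-cbag-p2` (prover-ym-line-cbag-p2-g2-0), route `ColdBoxAllGroups`, crux `BulkAllGroups`
(stmt-QuantumFields-22255), line `dlr-chessboard-G` (skeleton `Cruxes/BulkAllGroups/Lines/birth.lean` v5).
-/
import Summits.QuantumFields.YangMills.Theorems.ColdBoxAllGroupsBulkAllGroupsKernelCovDatumCoreG
import Summits.QuantumFields.YangMills.Theorems.ColdBoxAllGroupsBulkAllGroupsKernelMeanCore2G
import Summits.QuantumFields.YangMills.Theorems.ColdBoxAllGroupsBulkAllGroupsKernelMeanPrelimsG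

/-!
# Crux `BulkAllGroups` (stmt-QuantumFields-22255), stub `stub_kernelMeanExpansionG`: the one-scale expansion of a kernel MEAN with datum
# ASSEMBLED at fixed `β` — the deterministic mean core with datum, every compact group presented in `U(N)`

`G`-generic port of `Theorems/WeakCouplingRatesBulkDominatesColdBoxWKernelMeanTrunk.lean` (`abs_kernelMean_sub_le_of_trunk`; `SU(2)`, gnomonic
chart, three colours).  For the DLR box kernel `γ(·|W) = boxKernelG ρ β H W` of a faithful continuous unitary `ρ : G →* U(N)` (`D = dimE ρ`
colours) with an exterior datum in chart form off the cold box (`W e = expChart ρ (datVec ϑ e)`, `‖datVec ϑ e‖ ≤ r` off `Λ = boxEdges 4 (2H+1)`),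
at ANY plaquette `q = (x; i,j)` touching the cold box, given the T3 inputs (`hball` at radius `m ≤ 1/4`, chart density `c·g`, YM bad mass
`pY < 1`), the REAL inputs on the Gaussian window `S = goodTDE ρ H β ε ϑ ∩ {t | ∀ e, ‖unscaleTE H D β (t + μ') e‖ ≤ m}` (tilt bound `w`, surrogate
accuracy `τ` at `q`, bad mass `P ≤ 1/2`) and a bound `R'` on the scaled background circulations `F'_c(q) = sCirc(glue ϑ'_c (mean ϑ'_c))(q)`,
`ϑ' = sdatE β ϑ`,
**`abs_kernelMeanG_sub_gaussian_le_datum`**: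

  `|β·E_{γ(·|W)} c_q − ((D/2)·C(q,q) + ½Σ_c F'_c(q)²)| ≤ 2(2Nβ)·pY + M(e^{2w}−1) + τ + 2(1 + 2D²(R'⁴+3))·√P`,

`C = boxDirProjKernel H`, `M = β^{2ε}`.  Chain: T3' `integral_cond_boxKernelG_eq_integral_tilted_datum'`, the on-`S` bound
`beta_mul_plaqCostAt_mem_Icc_of_mem_goodTDE`, the cores' form `qObsDE_eq_half_sum_sq`, the `D`-colour A-mean core
`abs_kernelMeanG_sub_gaussian_le_core₂` (global bound `M₀ = 2Nβ`), and `Σ_c(F'_c⁴ + 3C(q,q)²) ≤ D(R'⁴+3)` (`C(q,q) ≤ 1` on touching plaquettes,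
`integral_dirCirc_sq_le_one_of_touching`).  The constant term is left in scaled units (`½Σ_c F'_c² = (β/2)Σ_c F̄_c²`, `half_sum_sq_sqrt_smul_eq`);
the stub file converts.  No sorry; no new definition; standard axioms.  NOT a claim about the mass gap: rung-level support (R2xi-G `XiPow`,
RECORD label); the Yang–Mills mass gap is NOT proved by any of this.
-/

set_option autoImplicit false

noncomputable section

open MeasureTheory ProbabilityTheory Finset Real Metric
open scoped ENNReal Matrix.Norms.Frobenius
open Literature.Probability.LatticeModels (Site)
open Literature.MathematicalPhysics.QuantumLattice
open Literature.MathematicalPhysics.QuantumFieldTheory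
open Literature.MathematicalPhysics.QuantumFieldTheory.LatticeMaxwell
open Literature.MathematicalPhysics.QuantumFieldTheory.AxialGauge
open Summit.QuantumFields.YangMills.Theorems.WeakCouplingRates
open Summit.QuantumFields.YangMills.Theorems.FreeEnergyLogCoefficient

namespace Summit.QuantumFields.YangMills.Theorems.ColdBoxAllGroups

variable {H : ℕ}

section Box

variable {N : ℕ} {G : Type} [Group G] (ρ : G →* Matrix (Fin N) (Fin N) ℂ)
variable [TopologicalSpace G] [IsTopologicalGroup G] [CompactSpace G] [MeasurableSpace G] [BorelSpace G] [SecondCountableTopology G]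

set_option maxHeartbeats 400000 in
/-- **The one-scale expansion of a kernel mean with datum, assembled at fixed `β` (deterministic mean core), every compact group presented in
`U(N)`, at any plaquette touching the cold box.**  See the module docstring. -/
theorem abs_kernelMeanG_sub_gaussian_le_datum (hρc : Continuous ρ) (hinj : Function.Injective ρ)
    (hρu : ∀ g, ρ g ∈ Matrix.unitaryGroup (Fin N) ℂ) {β ε r m w τ R' P pY : ℝ}
    {g : EuclideanSpace ℝ (Fin (dimE ρ)) → ℝ} (hgm : Measurable g)
    (hβ : 1 ≤ β) (hH : 1 ≤ H) (hr : 0 ≤ r) (hm4 : m ≤ 1 / 4)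
    {W : LGConfig 4 G} {ϑ : Fin (dimE ρ) → (Literature.MathematicalPhysics.QuantumLattice.ZdEdge 4 → ℝ)}
    (hW : ∀ e, e ∉ boxEdges 4 (2 * H + 1) → W e = expChart ρ (datVec ϑ e))
    (hϑ : ∀ e, e ∉ boxEdges 4 (2 * H + 1) → ‖datVec ϑ e‖ ≤ r)
    (hball : ∀ u : G, ‖ρ u - 1‖ ≤ (12 * (H : ℝ) ^ 2 + 2 * H + 1) * (Real.sqrt 2 * Real.sqrt (β ^ (2 * ε - 1)) + 8 * r) →
      u ∈ expChart ρ '' closedBall (0 : EuclideanSpace ℝ (Fin (dimE ρ))) m)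
    (hgpos : ∀ a, ‖a‖ ≤ m → 0 < g a) {c : ℝ≥0∞} (hc0 : c ≠ 0) (hctop : c ≠ ∞)
    (hdens : (chartMeasureE ρ (1 / 4)).restrict (closedBall 0 m) =
      (c • (volume : Measure (EuclideanSpace ℝ (Fin (dimE ρ)))).restrict (closedBall 0 m)).withDensity
        (fun a => ENNReal.ofReal (g a)))
    (hpY : (boxKernelG ρ β H W).real (coldGoodSetG ρ H β ε)ᶜ ≤ pY) (hpY1 : pY < 1)
    (hP : (gaussD H (dimE ρ)).real
        (goodTDE ρ H β ε ϑ ∩ {t | ∀ e, ‖unscaleTE H (dimE ρ) β (t + meanTE H (dimE ρ) β ϑ) e‖ ≤ m})ᶜ ≤ P) (hP2 : P ≤ 1 / 2)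
    (hWb : ∀ t ∈ goodTDE ρ H β ε ϑ ∩ {t | ∀ e, ‖unscaleTE H (dimE ρ) β (t + meanTE H (dimE ρ) β ϑ) e‖ ≤ m},
      |tiltWDE ρ H g β ϑ t| ≤ w)
    {x : Site 4} {i j : Fin 4} (hij : i < j) (hx : ((x, ⟨(i, j), hij⟩) : ZdPlaquette 4) ∈ plaquettesTouching (boxEdges 4 (2 * H + 1)))
    (hSur : ∀ t ∈ goodTDE ρ H β ε ϑ ∩ {t | ∀ e, ‖unscaleTE H (dimE ρ) β (t + meanTE H (dimE ρ) β ϑ) e‖ ≤ m},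
      |qObsDE H (dimE ρ) β ϑ (x, i, j) t - β * plaqCostAt ρ x i j (cfgTDE ρ H β ϑ t)| ≤ τ)
    (hF : ∀ c, |sCirc (glue (pin := fun e => e ∉ dirFreeEdges H) dirCorner (2 * H + 3) (sdatE β ϑ c)
        (mean (fun e => e ∉ dirFreeEdges H) dirCorner (2 * H + 3) (sdatE β ϑ c))) (x, i, j)| ≤ R') :
    |β * (∫ U, plaqCostAt ρ x i j U ∂(boxKernelG ρ β H W)) -
        ((dimE ρ : ℝ) / 2 * boxDirProjKernel H (x, i, j) (x, i, j) +
          1 / 2 * ∑ c, (sCirc (glue (pin := fun e => e ∉ dirFreeEdges H) dirCorner (2 * H + 3) (sdatE β ϑ c)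
            (mean (fun e => e ∉ dirFreeEdges H) dirCorner (2 * H + 3) (sdatE β ϑ c))) (x, i, j)) ^ 2)| ≤
      2 * (2 * N * β) * pY +
        (β ^ (2 * ε) * (Real.exp (2 * w) - 1) + τ + 2 * (1 + 2 * (dimE ρ : ℝ) ^ 2 * (R' ^ 4 + 3)) * Real.sqrt P) := by
  have hβ0 : 0 < β := by linarith
  -- abbreviations
  set μ := boxKernelG ρ β H W with hμ
  set Gd := coldGoodSetG ρ H β ε with hGd
  set γ : Measure (TSpaceD H (dimE ρ)) := gaussD H (dimE ρ) with hγ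
  set S : Set (TSpaceD H (dimE ρ)) := goodTDE ρ H β ε ϑ ∩
    {t | ∀ e, ‖unscaleTE H (dimE ρ) β (t + meanTE H (dimE ρ) β ϑ) e‖ ≤ m} with hS
  set F : Fin (dimE ρ) → ℝ := fun c => sCirc (glue (pin := fun e => e ∉ dirFreeEdges H) dirCorner (2 * H + 3) (sdatE β ϑ c)
      (mean (fun e => e ∉ dirFreeEdges H) dirCorner (2 * H + 3) (sdatE β ϑ c))) (x, i, j) with hF'
  set M : ℝ := β ^ (2 * ε) with hM
  have hM0 : 0 ≤ M := by positivity
  have hD0 : (0 : ℝ) ≤ (dimE ρ : ℝ) := Nat.cast_nonneg _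
  -- the two charged events
  have hGm : MeasurableSet Gd := measurableSet_coldGoodSetG ρ hρc β ε
  have hSm : MeasurableSet S :=
    (measurableSet_goodTDE ρ hρc hinj β ε ϑ).inter (measurableSet_ball_unscaleTE_add (dimE ρ) β m _)
  haveI : IsProbabilityMeasure μ := isProbabilityMeasure_boxKernelG ρ hρc β H W
  haveI : IsProbabilityMeasure γ := isProbabilityMeasure_gaussD H (dimE ρ)
  have hG0 : μ Gd ≠ 0 := measure_ne_zero_of_real_compl_lt_one μ hGm (hpY.trans_lt hpY1)
  have hS0 : γ S ≠ 0 := measure_ne_zero_of_real_compl_lt_one γ hSm (hP.trans_lt (by linarith))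
  -- the observable
  have hXm : Measurable fun U : LGConfig 4 G => β * plaqCostAt ρ x i j U := (measurable_plaqCostAt_of_continuous ρ hρc x i j).const_mul β
  have hXinv : IsZdGaugeInvariant fun U : LGConfig 4 G => β * plaqCostAt ρ x i j U := isZdGaugeInvariant_const_mul_plaqCostAtG ρ β x i j
  have hX0 : ∀ U : LGConfig 4 G, 0 ≤ β * plaqCostAt ρ x i j U := fun U => by
    refine mul_nonneg hβ0.le ?_
    simp only [plaqCostAt, plaquetteObs]
    rw [Literature.MathematicalPhysics.QuantumFieldTheory.sub_re_trace_eq_half_norm_sub_one_sq (hρu _)]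
    positivity
  have hN0 : (0 : ℝ) ≤ N := Nat.cast_nonneg _
  have hfM : ∀ U : LGConfig 4 G, |β * plaqCostAt ρ x i j U| ≤ 2 * N * β := fun U => by
    rw [abs_mul, abs_of_pos hβ0]
    nlinarith [abs_plaqCostAt_leG ρ hρu x i j U, abs_nonneg (plaqCostAt ρ x i j U)]
  -- T3': the representation
  have hRep : ∫ U, β * plaqCostAt ρ x i j U ∂(μ[|Gd]) =
      ∫ t, β * plaqCostAt ρ x i j (cfgTDE ρ H β ϑ t) ∂((γ[|S]).tilted (S.indicator (tiltWDE ρ H g β ϑ))) :=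
    integral_cond_boxKernelG_eq_integral_tilted_datum' ρ hρc hinj hρu hβ0 hH hr hm4 hball hW hϑ hgm hgpos hc0 hctop hdens hG0 hS0
      hXm hXinv hX0
  -- the tilt bound (indicator form)
  have hw0 : 0 ≤ w := by
    by_cases hne : S.Nonempty
    · obtain ⟨t, ht⟩ := hne; exact (abs_nonneg _).trans (hWb t ht)
    · exfalso; apply hS0; rw [Set.not_nonempty_iff_eq_empty.1 hne, measure_empty]
  have hWt : ∀ t, |S.indicator (tiltWDE ρ H g β ϑ) t| ≤ w := by
    intro t
    by_cases ht : t ∈ S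
    · rw [Set.indicator_of_mem ht]; exact hWb t ht
    · rw [Set.indicator_of_notMem ht, abs_zero]; exact hw0
  -- on-`S` bound and linearisation
  have hFS : ∀ t ∈ S, |β * plaqCostAt ρ x i j (cfgTDE ρ H β ϑ t)| ≤ M := by
    intro t ht
    obtain ⟨h0, h1⟩ := beta_mul_plaqCostAt_mem_Icc_of_mem_goodTDE ρ hρu hβ0 ht.1 hx
    rw [abs_of_nonneg h0]; exact h1
  have hSur' : ∀ t ∈ S, |β * plaqCostAt ρ x i j (cfgTDE ρ H β ϑ t) - 1 / 2 * ∑ c, (F c + dirCirc H (x, i, j) (t c)) ^ 2| ≤ τ := by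
    intro t ht
    have h := hSur t ht
    rw [qObsDE_eq_half_sum_sq, abs_sub_comm] at h
    exact h
  -- the `D`-colour A-mean core
  have hcore := abs_kernelMeanG_sub_gaussian_le_core₂ ρ hρc (H := H) (D := dimE ρ) (β := β) W x i j hGm hG0 hpY (M₀ := 2 * N * β)
    (M := M) hM0 hfM (cfgTDE ρ H β ϑ) (measurable_cfgTDE ρ hρc hinj β ϑ) hSm hS0 hP hP2 (measurable_tiltWDE ρ hρc hinj hgm β ϑ) hWt hRep
    F (x, i, j) hFS hSur'
  -- the moment constant: `Σ_c (F_c⁴ + 3C(q,q)²) ≤ D(R'⁴+3)`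
  have hC1 : boxDirProjKernel H (x, i, j) (x, i, j) ≤ 1 := by
    have h := integral_dirCirc_sq_le_one_of_touching (H := H) hx
    rw [integral_dirCirc_sq] at h; exact h
  have hC0 : 0 ≤ boxDirProjKernel H (x, i, j) (x, i, j) := boxDirProjKernel_self_nonneg _
  have hsum : ∑ c, (F c ^ 4 + 3 * boxDirProjKernel H (x, i, j) (x, i, j) ^ 2) ≤ (dimE ρ) * (R' ^ 4 + 3) := sum_pow_four_add_le hF hC0 hC1
  have hsqP : 0 ≤ Real.sqrt P := Real.sqrt_nonneg _
  have hmono : 2 * (1 + 2 * (dimE ρ : ℝ) * ∑ c, (F c ^ 4 + 3 * boxDirProjKernel H (x, i, j) (x, i, j) ^ 2)) * Real.sqrt P ≤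
      2 * (1 + 2 * (dimE ρ : ℝ) ^ 2 * (R' ^ 4 + 3)) * Real.sqrt P := by
    apply mul_le_mul_of_nonneg_right _ hsqP
    have : 2 * (dimE ρ : ℝ) * ∑ c, (F c ^ 4 + 3 * boxDirProjKernel H (x, i, j) (x, i, j) ^ 2) ≤ 2 * (dimE ρ : ℝ) * ((dimE ρ) * (R' ^ 4 + 3)) :=
      mul_le_mul_of_nonneg_left hsum (by positivity)
    nlinarith
  refine hcore.trans ?_
  linarith

end Box

end Summit.QuantumFields.YangMills.Theorems.ColdBoxAllGroups

end
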